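import Summits.MatrixMultiplication.MatrixMultiplication.Theorems.EdgePencilBlindMaximal
import HarnessLib

/-!
# Exponent constancy: every 4-party spectral point is an exact power on the pair, diamond and tetrahedron
# families — E-coordinates `(p_φ, d_φ)`, `φ[W_n^{(e)}] = e^{p_φ}·n^{d_φ}`, and the ladder as a support function

Support kernel for `stmt-MatrixMultiplication-26697` (`TetraExcessZero : ω(K₄) ≤ ω(2,1,2)`, route
`TetrahedronCarving`; cut of record `closes (TetraExcessZero) (TetraPlusTwo) : ω = 2`, UNCHANGED; lineage
`decomp-mm-lens-6`, generation 44; sequel of `EdgePencilAsymptoticRank`, `EdgePencilBlindMaximal`). No item is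
added or changed; no definition is introduced. Notation as there: `W_n^{(e)} = sixTetra F n e`, `D_n = W_n^{(1)}`,
`T(K₄)_n = tetra F n = W_n^{(n)}`, `P_e = (a ↦ [a 0 = a 1])` on `(Fin 4 → Fin e)`, `X₄(F) =
DTensorClass.asymptoticSpectrumDTensors F 2`, `[t] = DTensorClass.mk t`, `R̃ = asympRankOf (· ≤ ·)`,
`χ(δ) = omegaSix F δ`, `ψ = ω(2,1,2)`, `ω(K₄) = omegaTetra F`. The E-COORDINATES of `φ ∈ X₄(F)` are the two
numbers (spelled out in every statement, no `def`) `p_φ = log₂ φ[P_2] ∈ [0, 1]` (the `EPR₀₁`-rate) and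
`d_φ = log₂ φ[D_2] ∈ [0, ψ]` (the diamond rate).

§20 THE GENERIC LAW (`eq_rpow_logb_of_mul_of_mono`): a completely multiplicative, monotone `f : ℕ_{≥1} → ℝ`
with `f(1) = 1` is an exact power `f(m) = m^{log₂ f(2)}` (sandwich `2^j ≤ m^k < 2^{j+1}`: `f(m)^k` and
`(m^{p})^k` both lie in `[f(2)^j, f(2)^{j+1}]`, so their ratio is pinched in `[2^{-p}, 2^p]` for every `k`).

§21 THE THREE FAMILIES ARE POWERS (`spectrum_pair_eq_rpow`, `spectrum_diamond_eq_rpow`, `spectrum_tetra_eq_rpow`;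
multiplicativity from `mk_sixTetra_mul` and the pair factor `φ[W_n^{(e)}] = φ[P_e]·φ[D_n]`, monotonicity from
bond/level monotonicity): for every `φ ∈ X₄(F)` and `m ≥ 1`, `1 ≤ e ≤ n`,

  `φ[P_m] = m^{p_φ}`,  `φ[D_m] = m^{d_φ}`,  `φ[T(K₄)_m] = m^{p_φ + d_φ}`,  `φ[W_n^{(e)}] = e^{p_φ}·n^{d_φ}`

(`spectrum_sixTetra_eq_rpow_mul_rpow`) — a point's footprint on the whole pencil is TWO numbers.

§22 THE LADDER IS A SUPPORT FUNCTION (`coord_le_omegaSix`, `exists_coord_eq_omegaSix`; from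
`EdgePencilAsymptoticRank.rpow_omegaSix_logb_eq_asympRank` and `R̃ = max_φ φ`): for `2 ≤ n`, `1 ≤ e ≤ n`,
`δ = log_n e`:  `χ(δ) = max_{φ ∈ X₄} (d_φ + δ·p_φ)`,  `ω(K₄) = max_φ (p_φ + d_φ)`,  `ψ = max_φ d_φ`,  each
maximum attained — on the bonds `e ≤ n`, `χ` is the support function of the compact planar set
`E = {(p_φ, d_φ)} ⊂ [0,1] × [0,ψ]` in direction `(δ, 1)` (whence its convexity and monotonicity,
`EdgePencilSixthConvexity`). THE LEAF IN COORDINATES (`tetraExcessZero_iff_coord`, `…_iff_forall_coord`):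

  `TetraExcessZero ⟺ ∃ φ ∈ X₄(ℂ), p_φ = 0 ∧ p_φ + d_φ = ω(K₄) ⟺ ∀ φ ∈ X₄(ℂ), p_φ + d_φ ≤ ψ`

— the maximum of `p + d` over `E` is attained ON THE AXIS `p = 0` (flattenings sit at `(0,4)`, `(1,3)`, `(1,3)`).

References: Strassen 1988, Thm. 3.8 [Strassen1988]; Zuiddam 2018, Thm. 2.12, Cor. 2.13 [Zuiddam2018];
Christandl–Vrana–Zuiddam 2023, Thm. 1.1, Prop. 1.6 [ChristandlVranaZuiddam2023]; Christandl–Vrana–Zuiddam,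
arXiv:1609.07476, §1.1 [ChristandlVranaZuiddam2016]. No `sorry`, no new axiom, no instance, no notation,
no definition.
-/

noncomputable section

set_option linter.dupNamespace false

open Filter Finset Literature.Computability.AlgebraicComplexity
open Summit.MatrixMultiplication.MatrixMultiplication.Theorems.TetrahedronTensor
open Summit.MatrixMultiplication.MatrixMultiplication.Theorems.TetraDiagonal
open Summit.MatrixMultiplication.MatrixMultiplication.Theses.TetrahedronCarving

namespace Summit.MatrixMultiplication.MatrixMultiplication.Theorems.EdgePencil

/-! ## §20 A completely multiplicative monotone sequence is an exact power -/

section PowerLaw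

/-- Powers: `f(a^k) = f(a)^k` for a completely multiplicative `f` with `f(1) = 1` (`a ≥ 1`). [folklore] -/
theorem map_pow_of_mul {f : ℕ → ℝ} (hmul : ∀ a b : ℕ, 1 ≤ a → 1 ≤ b → f (a * b) = f a * f b)
    (h1 : f 1 = 1) {a : ℕ} (ha : 1 ≤ a) (k : ℕ) : f (a ^ k) = f a ^ k := by
  induction k with
  | zero => rw [pow_zero, pow_zero, h1]
  | succ k ih => rw [pow_succ, hmul _ _ (Nat.one_le_pow _ _ ha) ha, ih, pow_succ]

/-- **EXPONENT CONSTANCY.** A completely multiplicative, monotone `f : ℕ_{≥1} → ℝ` with `f(1) = 1` is an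
exact power: `f(m) = m^{log₂ f(2)}` for every `m ≥ 1`. [folklore] -/
theorem eq_rpow_logb_of_mul_of_mono {f : ℕ → ℝ}
    (hmul : ∀ a b : ℕ, 1 ≤ a → 1 ≤ b → f (a * b) = f a * f b)
    (hmono : ∀ a b : ℕ, 1 ≤ a → a ≤ b → f a ≤ f b) (h1 : f 1 = 1) {m : ℕ} (hm : 1 ≤ m) :
    f m = (m : ℝ) ^ Real.logb 2 (f 2) := by
  set p : ℝ := Real.logb 2 (f 2) with hp
  have hf2 : 1 ≤ f 2 := by rw [← h1]; exact hmono 1 2 le_rfl one_le_two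
  have hf2pos : 0 < f 2 := by linarith
  have hp0 : 0 ≤ p := Real.logb_nonneg one_lt_two hf2
  have h2p : (2 : ℝ) ^ p = f 2 := Real.rpow_logb two_pos (by norm_num) hf2pos
  have hfm : 1 ≤ f m := by rw [← h1]; exact hmono 1 m le_rfl hm
  have hm0 : (0 : ℝ) < m := by exact_mod_cast hm
  have hmp : 0 < (m : ℝ) ^ p := Real.rpow_pos_of_pos hm0 p
  have hswap : ∀ (x : ℝ) (j : ℕ), 0 ≤ x → (x ^ j) ^ p = (x ^ p) ^ j := fun x j hx => by
    rw [← Real.rpow_natCast_mul hx, mul_comm, Real.rpow_mul_natCast hx]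
  have key : ∀ k : ℕ, f m ^ k ≤ (2 : ℝ) ^ p * ((m : ℝ) ^ p) ^ k ∧
      ((m : ℝ) ^ p) ^ k ≤ (2 : ℝ) ^ p * f m ^ k := by
    intro k
    have hmk : 1 ≤ m ^ k := Nat.one_le_pow _ _ hm
    set j : ℕ := Nat.log 2 (m ^ k) with hj
    have hlo : 2 ^ j ≤ m ^ k := Nat.pow_log_le_self 2 (by omega)
    have hhi : m ^ k < 2 ^ (j + 1) := Nat.lt_pow_succ_log_self one_lt_two _
    have hlo' : ((2 : ℝ) ^ j) ≤ ((m : ℝ) ^ k) := by exact_mod_cast hlo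
    have hhi' : ((m : ℝ) ^ k) ≤ ((2 : ℝ) ^ (j + 1)) := by exact_mod_cast hhi.le
    have hfmk : f m ^ k = f (m ^ k) := (map_pow_of_mul hmul h1 hm k).symm
    have hf2j : f (2 ^ j) = ((2 : ℝ) ^ p) ^ j := by rw [map_pow_of_mul hmul h1 one_le_two, h2p]
    have hf2j1 : f (2 ^ (j + 1)) = ((2 : ℝ) ^ p) ^ (j + 1) := by
      rw [map_pow_of_mul hmul h1 one_le_two, h2p]
    constructor
    · calc f m ^ k = f (m ^ k) := hfmk
        _ ≤ f (2 ^ (j + 1)) := hmono _ _ hmk hhi.le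
        _ = (2 : ℝ) ^ p * ((2 : ℝ) ^ p) ^ j := by rw [hf2j1, pow_succ, mul_comm]
        _ = (2 : ℝ) ^ p * (((2 : ℝ) ^ j) ^ p) := by rw [hswap 2 j two_pos.le]
        _ ≤ (2 : ℝ) ^ p * (((m : ℝ) ^ k) ^ p) :=
            mul_le_mul_of_nonneg_left (Real.rpow_le_rpow (by positivity) hlo' hp0) (by positivity)
        _ = (2 : ℝ) ^ p * ((m : ℝ) ^ p) ^ k := by rw [hswap _ k hm0.le]
    · calc ((m : ℝ) ^ p) ^ k = ((m : ℝ) ^ k) ^ p := (hswap _ k hm0.le).symm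
        _ ≤ ((2 : ℝ) ^ (j + 1)) ^ p := Real.rpow_le_rpow (by positivity) hhi' hp0
        _ = (2 : ℝ) ^ p * ((2 : ℝ) ^ p) ^ j := by rw [hswap 2 (j + 1) two_pos.le, pow_succ, mul_comm]
        _ = (2 : ℝ) ^ p * f (2 ^ j) := by rw [hf2j]
        _ ≤ (2 : ℝ) ^ p * f (m ^ k) :=
            mul_le_mul_of_nonneg_left (hmono _ _ Nat.one_le_two_pow hlo) (by positivity)
        _ = (2 : ℝ) ^ p * f m ^ k := by rw [hfmk]
  refine le_antisymm ?_ ?_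
  · exact le_of_pow_le_mul_pow_eventually hmp (Eventually.of_forall fun k => (key k).1)
  · exact le_of_pow_le_mul_pow_eventually (by linarith) (Eventually.of_forall fun k => (key k).2)

end PowerLaw

/-! ## §21 The pair, diamond and tetrahedron families are exact powers at every spectral point -/

section Families

variable {F : Type*} [Field F]

/-- `φ[D_a]·φ[D_b] = φ[D_{ab}]` (`1 ≤ a, b`; `[D_a]·[D_b] = [D_{ab}]`). [cite: ChristandlVranaZuiddam2016, Prop. 1.1.16] -/
theorem spectrum_diamond_mul {a b : ℕ} (ha : 1 ≤ a) (hb : 1 ≤ b) {φ : DTensorClass F 4 → ℝ}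
    (hφ : φ ∈ DTensorClass.asymptoticSpectrumDTensors F 2) :
    φ (DTensorClass.mk (sixTetra F (a * b) 1)) =
      φ (DTensorClass.mk (sixTetra F a 1)) * φ (DTensorClass.mk (sixTetra F b 1)) := by
  rw [← (DTensorClass.mem_asymptoticSpectrumDTensors_iff.1 hφ).map_mul, mk_sixTetra_mul ha hb, mul_one]

/-- `φ[T(K₄)_a]·φ[T(K₄)_b] = φ[T(K₄)_{ab}]`. [cite: ChristandlVranaZuiddam2016, Prop. 1.1.16] -/
theorem spectrum_tetra_mul (a b : ℕ) {φ : DTensorClass F 4 → ℝ}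
    (hφ : φ ∈ DTensorClass.asymptoticSpectrumDTensors F 2) :
    φ (DTensorClass.mk (tetra F (a * b))) =
      φ (DTensorClass.mk (tetra F a)) * φ (DTensorClass.mk (tetra F b)) := by
  rw [← sixTetra_of_le (le_refl (a * b)), ← sixTetra_of_le (le_refl a), ← sixTetra_of_le (le_refl b),
    ← (DTensorClass.mem_asymptoticSpectrumDTensors_iff.1 hφ).map_mul, mk_sixTetra_mul le_rfl le_rfl]

/-- **`φ[P_a]·φ[P_b] = φ[P_{ab}]`** (`1 ≤ a, b`; divide `φ[T_{ab}] = φ[T_a]·φ[T_b]` by `φ[D_{ab}] = φ[D_a]·φ[D_b]`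
using the pair factor `φ[T_m] = φ[P_m]·φ[D_m]`). [cite: Zuiddam2018, Thm. 2.12] -/
theorem spectrum_pair_mul {a b : ℕ} (ha : 1 ≤ a) (hb : 1 ≤ b) {φ : DTensorClass F 4 → ℝ}
    (hφ : φ ∈ DTensorClass.asymptoticSpectrumDTensors F 2) :
    φ (DTensorClass.mk (fun i : Fin 4 → Fin (a * b) => (ind (i 0 = i 1) : F))) =
      φ (DTensorClass.mk (fun i : Fin 4 → Fin a => (ind (i 0 = i 1) : F))) *
        φ (DTensorClass.mk (fun i : Fin 4 → Fin b => (ind (i 0 = i 1) : F))) := by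
  have hab : 1 ≤ a * b := Nat.one_le_iff_ne_zero.2 (Nat.mul_ne_zero (by omega) (by omega))
  have hDa : 0 < φ (DTensorClass.mk (sixTetra F a 1)) := one_pos.trans_le (one_le_spectrum_sixTetra ha le_rfl hφ)
  have hDb : 0 < φ (DTensorClass.mk (sixTetra F b 1)) := one_pos.trans_le (one_le_spectrum_sixTetra hb le_rfl hφ)
  have hT := spectrum_sixTetra_eq_pair_mul hab le_rfl hφ
  rw [← mk_sixTetra_mul (le_refl a) (le_refl b), (DTensorClass.mem_asymptoticSpectrumDTensors_iff.1 hφ).map_mul,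
    spectrum_sixTetra_eq_pair_mul ha le_rfl hφ, spectrum_sixTetra_eq_pair_mul hb le_rfl hφ,
    spectrum_diamond_mul ha hb hφ] at hT
  have hD : (0 : ℝ) < φ (DTensorClass.mk (sixTetra F a 1)) * φ (DTensorClass.mk (sixTetra F b 1)) := mul_pos hDa hDb
  have h2 : φ (DTensorClass.mk (fun i : Fin 4 → Fin (a * b) => (ind (i 0 = i 1) : F))) *
      (φ (DTensorClass.mk (sixTetra F a 1)) * φ (DTensorClass.mk (sixTetra F b 1))) =
      (φ (DTensorClass.mk (fun i : Fin 4 → Fin a => (ind (i 0 = i 1) : F))) *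
        φ (DTensorClass.mk (fun i : Fin 4 → Fin b => (ind (i 0 = i 1) : F)))) *
      (φ (DTensorClass.mk (sixTetra F a 1)) * φ (DTensorClass.mk (sixTetra F b 1))) := by
    rw [← hT]; ring
  exact mul_right_cancel₀ hD.ne' h2

/-- `φ[P_a] ≤ φ[P_b]` for `1 ≤ a ≤ b` (`φ[P_a]·φ[D_b] = φ[W_b^{(a)}] ≤ φ[W_b^{(b)}] = φ[P_b]·φ[D_b]`).
[cite: Zuiddam2018, Thm. 2.12] -/
theorem spectrum_pair_mono {a b : ℕ} (ha : 1 ≤ a) (hab : a ≤ b) {φ : DTensorClass F 4 → ℝ}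
    (hφ : φ ∈ DTensorClass.asymptoticSpectrumDTensors F 2) :
    φ (DTensorClass.mk (fun i : Fin 4 → Fin a => (ind (i 0 = i 1) : F))) ≤
      φ (DTensorClass.mk (fun i : Fin 4 → Fin b => (ind (i 0 = i 1) : F))) := by
  have hb : 1 ≤ b := ha.trans hab
  have hDb : 0 < φ (DTensorClass.mk (sixTetra F b 1)) := one_pos.trans_le (one_le_spectrum_sixTetra hb le_rfl hφ)
  have h := (DTensorClass.mem_asymptoticSpectrumDTensors_iff.1 hφ).mono (mk_sixTetra_mono (F := F) (n := b) hab)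
  rw [spectrum_sixTetra_eq_pair_mul hb hab hφ, spectrum_sixTetra_eq_pair_mul hb le_rfl hφ] at h
  exact le_of_mul_le_mul_right h hDb

/-- `φ[P_1] = 1`. [cite: Zuiddam2018, Thm. 2.12] -/
theorem spectrum_pair_one {φ : DTensorClass F 4 → ℝ} (hφ : φ ∈ DTensorClass.asymptoticSpectrumDTensors F 2) :
    φ (DTensorClass.mk (fun i : Fin 4 → Fin 1 => (ind (i 0 = i 1) : F))) = 1 := by
  have h := spectrum_sixTetra_eq_pair_mul (le_refl 1) (le_refl 1) hφ
  have hD : 0 < φ (DTensorClass.mk (sixTetra F 1 1)) := one_pos.trans_le (one_le_spectrum_sixTetra le_rfl le_rfl hφ)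
  have h' : φ (DTensorClass.mk (fun i : Fin 4 → Fin 1 => (ind (i 0 = i 1) : F))) *
      φ (DTensorClass.mk (sixTetra F 1 1)) = 1 * φ (DTensorClass.mk (sixTetra F 1 1)) := by
    rw [one_mul]; exact h.symm
  exact mul_right_cancel₀ hD.ne' h'

/-- `φ[D_1] = 1`. [cite: ChristandlVranaZuiddam2016, Prop. 1.1.16] -/
theorem spectrum_diamond_one {φ : DTensorClass F 4 → ℝ} (hφ : φ ∈ DTensorClass.asymptoticSpectrumDTensors F 2) :
    φ (DTensorClass.mk (sixTetra F 1 1)) = 1 := by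
  have h : φ (DTensorClass.mk (sixTetra F 1 1)) =
      φ (DTensorClass.mk (sixTetra F 1 1)) * φ (DTensorClass.mk (sixTetra F 1 1)) :=
    spectrum_diamond_mul (le_refl 1) (le_refl 1) hφ
  have hD : 0 < φ (DTensorClass.mk (sixTetra F 1 1)) := one_pos.trans_le (one_le_spectrum_sixTetra le_rfl le_rfl hφ)
  have h' : φ (DTensorClass.mk (sixTetra F 1 1)) * φ (DTensorClass.mk (sixTetra F 1 1)) =
      1 * φ (DTensorClass.mk (sixTetra F 1 1)) := by
    rw [one_mul]; exact h.symm
  exact mul_right_cancel₀ hD.ne' h'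

/-- `φ[T(K₄)_1] = 1`. [cite: ChristandlVranaZuiddam2016, Prop. 1.1.16] -/
theorem spectrum_tetra_one {φ : DTensorClass F 4 → ℝ} (hφ : φ ∈ DTensorClass.asymptoticSpectrumDTensors F 2) :
    φ (DTensorClass.mk (tetra F 1)) = 1 := by
  rw [← sixTetra_of_le (le_refl 1)]
  exact spectrum_diamond_one hφ

/-- **THE PAIR FAMILY IS A POWER**: `φ[P_m] = m^{p_φ}`, `p_φ = log₂ φ[P_2]` (`m ≥ 1`). [cite: Strassen1988, Thm. 3.8] -/
theorem spectrum_pair_eq_rpow {φ : DTensorClass F 4 → ℝ} (hφ : φ ∈ DTensorClass.asymptoticSpectrumDTensors F 2)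
    {m : ℕ} (hm : 1 ≤ m) :
    φ (DTensorClass.mk (fun i : Fin 4 → Fin m => (ind (i 0 = i 1) : F))) =
      (m : ℝ) ^ Real.logb 2 (φ (DTensorClass.mk (fun i : Fin 4 → Fin 2 => (ind (i 0 = i 1) : F)))) :=
  eq_rpow_logb_of_mul_of_mono
    (f := fun m => φ (DTensorClass.mk (fun i : Fin 4 → Fin m => (ind (i 0 = i 1) : F))))
    (fun _ _ ha hb => spectrum_pair_mul ha hb hφ) (fun _ _ ha hab => spectrum_pair_mono ha hab hφ)
    (spectrum_pair_one hφ) hm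

/-- **THE DIAMOND FAMILY IS A POWER**: `φ[D_m] = m^{d_φ}`, `d_φ = log₂ φ[D_2]` (`m ≥ 1`). [cite: Strassen1988, Thm. 3.8] -/
theorem spectrum_diamond_eq_rpow {φ : DTensorClass F 4 → ℝ}
    (hφ : φ ∈ DTensorClass.asymptoticSpectrumDTensors F 2) {m : ℕ} (hm : 1 ≤ m) :
    φ (DTensorClass.mk (sixTetra F m 1)) =
      (m : ℝ) ^ Real.logb 2 (φ (DTensorClass.mk (sixTetra F 2 1))) :=
  eq_rpow_logb_of_mul_of_mono (f := fun m => φ (DTensorClass.mk (sixTetra F m 1)))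
    (fun _ _ ha hb => spectrum_diamond_mul ha hb hφ)
    (fun _ _ _ hab => (DTensorClass.mem_asymptoticSpectrumDTensors_iff.1 hφ).mono
      (mk_sixTetra_mono_level hab 1))
    (spectrum_diamond_one hφ) hm

/-- **THE TETRAHEDRON FAMILY IS A POWER**: `φ[T(K₄)_m] = m^{log₂ φ[T(K₄)_2]}` (`m ≥ 1`). [cite: Strassen1988, Thm. 3.8] -/
theorem spectrum_tetra_eq_rpow {φ : DTensorClass F 4 → ℝ}
    (hφ : φ ∈ DTensorClass.asymptoticSpectrumDTensors F 2) {m : ℕ} (hm : 1 ≤ m) :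
    φ (DTensorClass.mk (tetra F m)) = (m : ℝ) ^ Real.logb 2 (φ (DTensorClass.mk (tetra F 2))) := by
  refine eq_rpow_logb_of_mul_of_mono (f := fun m => φ (DTensorClass.mk (tetra F m)))
    (fun a b _ _ => spectrum_tetra_mul a b hφ) (fun a b _ hab => ?_) (spectrum_tetra_one hφ) hm
  show φ (DTensorClass.mk (tetra F a)) ≤ φ (DTensorClass.mk (tetra F b))
  rw [← sixTetra_of_le (le_refl a), ← sixTetra_of_le (le_refl b)]
  exact (DTensorClass.mem_asymptoticSpectrumDTensors_iff.1 hφ).mono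
    ((mk_sixTetra_mono_level hab a).trans (mk_sixTetra_mono hab))

/-- **`τ_φ = p_φ + d_φ`**: `log₂ φ[T(K₄)_2] = log₂ φ[P_2] + log₂ φ[D_2]`. [cite: Zuiddam2018, Thm. 2.12] -/
theorem logb_spectrum_tetra_two {φ : DTensorClass F 4 → ℝ}
    (hφ : φ ∈ DTensorClass.asymptoticSpectrumDTensors F 2) :
    Real.logb 2 (φ (DTensorClass.mk (tetra F 2))) =
      Real.logb 2 (φ (DTensorClass.mk (fun i : Fin 4 → Fin 2 => (ind (i 0 = i 1) : F)))) +
        Real.logb 2 (φ (DTensorClass.mk (sixTetra F 2 1))) := by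
  have hP : 0 < φ (DTensorClass.mk (fun i : Fin 4 → Fin 2 => (ind (i 0 = i 1) : F))) :=
    one_pos.trans_le (one_le_spectrum_pair (by norm_num) hφ)
  have hD : 0 < φ (DTensorClass.mk (sixTetra F 2 1)) := one_pos.trans_le (one_le_spectrum_sixTetra (by norm_num) le_rfl hφ)
  rw [← sixTetra_of_le (le_refl 2), spectrum_sixTetra_eq_pair_mul (by norm_num) le_rfl hφ,
    Real.logb_mul hP.ne' hD.ne']

/-- **A POINT'S FOOTPRINT IS TWO NUMBERS**: `φ[W_n^{(e)}] = e^{p_φ}·n^{d_φ}` (`1 ≤ e ≤ n`). [cite: Zuiddam2018, Thm. 2.12] -/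
theorem spectrum_sixTetra_eq_rpow_mul_rpow {n e : ℕ} (he1 : 1 ≤ e) (he : e ≤ n)
    {φ : DTensorClass F 4 → ℝ} (hφ : φ ∈ DTensorClass.asymptoticSpectrumDTensors F 2) :
    φ (DTensorClass.mk (sixTetra F n e)) =
      (e : ℝ) ^ Real.logb 2 (φ (DTensorClass.mk (fun i : Fin 4 → Fin 2 => (ind (i 0 = i 1) : F)))) *
        (n : ℝ) ^ Real.logb 2 (φ (DTensorClass.mk (sixTetra F 2 1))) := by
  rw [spectrum_sixTetra_eq_pair_mul (he1.trans he) he hφ, spectrum_pair_eq_rpow hφ he1,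
    spectrum_diamond_eq_rpow hφ (he1.trans he)]

/-- **Range of the pair coordinate**: `0 ≤ p_φ ≤ 1` (`1 ≤ φ[P_2] ≤ 2`). [cite: Zuiddam2018, Def. 2.11] -/
theorem coord_pair_mem {φ : DTensorClass F 4 → ℝ} (hφ : φ ∈ DTensorClass.asymptoticSpectrumDTensors F 2) :
    0 ≤ Real.logb 2 (φ (DTensorClass.mk (fun i : Fin 4 → Fin 2 => (ind (i 0 = i 1) : F)))) ∧
      Real.logb 2 (φ (DTensorClass.mk (fun i : Fin 4 → Fin 2 => (ind (i 0 = i 1) : F)))) ≤ 1 := by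
  have h1 : 1 ≤ φ (DTensorClass.mk (fun i : Fin 4 → Fin 2 => (ind (i 0 = i 1) : F))) :=
    one_le_spectrum_pair (by norm_num) hφ
  have h2 : φ (DTensorClass.mk (fun i : Fin 4 → Fin 2 => (ind (i 0 = i 1) : F))) ≤ 2 := by
    exact_mod_cast spectrum_pair_le (F := F) (by norm_num : 1 ≤ 2) hφ
  refine ⟨Real.logb_nonneg one_lt_two h1, ?_⟩
  rw [← Real.logb_self_eq_one one_lt_two]
  exact Real.logb_le_logb_of_le one_lt_two (by linarith) h2

end Families

/-! ## §22 The ladder is the support function of the E-coordinates; the leaf in coordinates -/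

section Support

variable (F : Type) [Field F]

/-- **Range of the diamond coordinate**: `0 ≤ d_φ ≤ ψ`. [cite: Strassen1988, Thm. 3.8] -/
theorem coord_diamond_mem {φ : DTensorClass F 4 → ℝ} (hφ : φ ∈ DTensorClass.asymptoticSpectrumDTensors F 2) :
    0 ≤ Real.logb 2 (φ (DTensorClass.mk (sixTetra F 2 1))) ∧
      Real.logb 2 (φ (DTensorClass.mk (sixTetra F 2 1))) ≤ omegaRect F 2 1 2 := by
  refine ⟨Real.logb_nonneg one_lt_two (one_le_spectrum_sixTetra (by norm_num) le_rfl hφ), ?_⟩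
  have h := logb_spectrum_diamond_le_omegaRect F (le_refl 2) hφ
  rwa [Nat.cast_ofNat] at h

/-- **EVERY POINT LIES UNDER THE LADDER**: `d_φ + (log_n e)·p_φ ≤ χ(log_n e)` (`1 ≤ e ≤ n`). [cite: Strassen1988, Thm. 3.8] -/
theorem coord_le_omegaSix {n e : ℕ} (hn : 2 ≤ n) (he1 : 1 ≤ e) (he : e ≤ n)
    {φ : DTensorClass F 4 → ℝ} (hφ : φ ∈ DTensorClass.asymptoticSpectrumDTensors F 2) :
    Real.logb 2 (φ (DTensorClass.mk (sixTetra F 2 1))) +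
        Real.logb n e * Real.logb 2 (φ (DTensorClass.mk (fun i : Fin 4 → Fin 2 => (ind (i 0 = i 1) : F)))) ≤
      omegaSix F (Real.logb n e) := by
  have hn1' : (1 : ℝ) < n := by exact_mod_cast (show 1 < n by omega)
  have hn0 : (0 : ℝ) < n := by linarith
  have he0 : (0 : ℝ) < e := by exact_mod_cast he1
  set p := Real.logb 2 (φ (DTensorClass.mk (fun i : Fin 4 → Fin 2 => (ind (i 0 = i 1) : F)))) with hp
  set d := Real.logb 2 (φ (DTensorClass.mk (sixTetra F 2 1))) with hd
  have hW := spectrum_sixTetra_le_rpow_omegaSix_logb F hn he1 he hφ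
  rw [spectrum_sixTetra_eq_rpow_mul_rpow he1 he hφ, ← hp, ← hd] at hW
  -- `e^p · n^d = n^(d + log_n e · p)`
  have hE : (e : ℝ) ^ p * (n : ℝ) ^ d = (n : ℝ) ^ (d + Real.logb n e * p) := by
    rw [Real.rpow_add hn0, mul_comm, Real.rpow_mul hn0.le, Real.rpow_logb hn0 hn1'.ne' he0]
  rw [hE] at hW
  exact (Real.rpow_le_rpow_left_iff hn1').1 hW

/-- **THE LADDER IS ATTAINED IN COORDINATES**: some `φ ∈ X₄(F)` has `d_φ + (log_n e)·p_φ = χ(log_n e)`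
(`2 ≤ n`, `1 ≤ e ≤ n`); with `coord_le_omegaSix`: `χ(δ) = max_φ (d_φ + δ p_φ)` at `δ = log_n e` — the
support function of `E = {(p_φ, d_φ)}`. [cite: Zuiddam2018, Cor. 2.13] -/
theorem exists_coord_eq_omegaSix {n e : ℕ} (hn : 2 ≤ n) (he1 : 1 ≤ e) (he : e ≤ n) :
    ∃ φ ∈ DTensorClass.asymptoticSpectrumDTensors F 2,
      Real.logb 2 (φ (DTensorClass.mk (sixTetra F 2 1))) +
          Real.logb n e * Real.logb 2 (φ (DTensorClass.mk (fun i : Fin 4 → Fin 2 => (ind (i 0 = i 1) : F)))) =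
        omegaSix F (Real.logb n e) := by
  have hn1' : (1 : ℝ) < n := by exact_mod_cast (show 1 < n by omega)
  have hn0 : (0 : ℝ) < n := by linarith
  have he0 : (0 : ℝ) < e := by exact_mod_cast he1
  obtain ⟨φ, hφ, hφeq⟩ := exists_spectrum_apply_sixTetra_eq_rpow_omegaSix F hn he1 he
  refine ⟨φ, hφ, ?_⟩
  set p := Real.logb 2 (φ (DTensorClass.mk (fun i : Fin 4 → Fin 2 => (ind (i 0 = i 1) : F)))) with hp
  set d := Real.logb 2 (φ (DTensorClass.mk (sixTetra F 2 1))) with hd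
  -- `e^p · n^d = n^(d + log_n e · p) = n^χ`: take `log_n`
  have hE : (e : ℝ) ^ p * (n : ℝ) ^ d = (n : ℝ) ^ (d + Real.logb n e * p) := by
    rw [Real.rpow_add hn0, mul_comm ((n : ℝ) ^ d), Real.rpow_mul hn0.le, Real.rpow_logb hn0 hn1'.ne' he0]
  rw [spectrum_sixTetra_eq_rpow_mul_rpow he1 he hφ, ← hp, ← hd, hE] at hφeq
  have h := congrArg (Real.logb n) hφeq
  rwa [Real.logb_rpow hn0 hn1'.ne', Real.logb_rpow hn0 hn1'.ne'] at h

/-- **`p_φ + d_φ ≤ ω(K₄)`** for every `φ ∈ X₄(F)`. [cite: Strassen1988, Thm. 3.8] -/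
theorem coord_sum_le_omegaTetra {φ : DTensorClass F 4 → ℝ}
    (hφ : φ ∈ DTensorClass.asymptoticSpectrumDTensors F 2) :
    Real.logb 2 (φ (DTensorClass.mk (fun i : Fin 4 → Fin 2 => (ind (i 0 = i 1) : F)))) +
        Real.logb 2 (φ (DTensorClass.mk (sixTetra F 2 1))) ≤ omegaTetra F := by
  rw [← logb_spectrum_tetra_two hφ]
  have h := logb_spectrum_tetra_le_omegaTetra F (le_refl 2) hφ
  rwa [Nat.cast_ofNat] at h

/-- **`ω(K₄) = max_φ (p_φ + d_φ)`, attained.** [cite: Zuiddam2018, Cor. 2.13] -/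
theorem exists_coord_sum_eq_omegaTetra :
    ∃ φ ∈ DTensorClass.asymptoticSpectrumDTensors F 2,
      Real.logb 2 (φ (DTensorClass.mk (fun i : Fin 4 → Fin 2 => (ind (i 0 = i 1) : F)))) +
          Real.logb 2 (φ (DTensorClass.mk (sixTetra F 2 1))) = omegaTetra F := by
  obtain ⟨φ, hφ, hφeq⟩ := exists_spectrum_apply_tetra_eq_rpow_omegaTetra F (le_refl 2)
  refine ⟨φ, hφ, ?_⟩
  rw [← logb_spectrum_tetra_two hφ, hφeq, Nat.cast_ofNat, Real.logb_rpow two_pos (by norm_num)]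

/-- **`ψ = max_φ d_φ`, attained.** [cite: Zuiddam2018, Cor. 2.13] -/
theorem exists_coord_diamond_eq_omegaRect :
    ∃ φ ∈ DTensorClass.asymptoticSpectrumDTensors F 2,
      Real.logb 2 (φ (DTensorClass.mk (sixTetra F 2 1))) = omegaRect F 2 1 2 := by
  obtain ⟨φ, hφ, hφeq⟩ := exists_spectrum_apply_diamond_eq_rpow_omegaRect F (le_refl 2)
  refine ⟨φ, hφ, ?_⟩
  rw [hφeq, Nat.cast_ofNat, Real.logb_rpow two_pos (by norm_num)]

/-- **THE LEAF IN COORDINATES**: `TetraExcessZero ⟺ ∃ φ ∈ X₄(ℂ), p_φ = 0 ∧ p_φ + d_φ = ω(K₄)` (the maximum of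
`p + d` over `E` is attained on the axis `p = 0`). [cite: Strassen1988, Thm. 3.8] -/
theorem tetraExcessZero_iff_coord :
    TetraExcessZero ↔
      ∃ φ ∈ DTensorClass.asymptoticSpectrumDTensors ℂ 2,
        Real.logb 2 (φ (DTensorClass.mk (fun i : Fin 4 → Fin 2 => (ind (i 0 = i 1) : ℂ)))) = 0 ∧
          Real.logb 2 (φ (DTensorClass.mk (fun i : Fin 4 → Fin 2 => (ind (i 0 = i 1) : ℂ)))) +
            Real.logb 2 (φ (DTensorClass.mk (sixTetra ℂ 2 1))) = omegaTetra ℂ := by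
  rw [tetraExcessZero_iff_exists_maximal_pair_eq_one (le_refl 2)]
  refine exists_congr fun φ => and_congr_right fun hφ => ?_
  have hP : 1 ≤ φ (DTensorClass.mk (fun i : Fin 4 → Fin 2 => (ind (i 0 = i 1) : ℂ))) :=
    one_le_spectrum_pair (by norm_num) hφ
  have hT : 0 < φ (DTensorClass.mk (tetra ℂ 2)) := by
    have h := one_le_spectrum_sixTetra (F := ℂ) (by norm_num : 1 ≤ 2) (by norm_num : 1 ≤ 2) hφ
    rw [sixTetra_of_le (le_refl 2)] at h
    linarith
  have hP0 : 0 < φ (DTensorClass.mk (fun i : Fin 4 → Fin 2 => (ind (i 0 = i 1) : ℂ))) := by linarith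
  rw [← logb_spectrum_tetra_two hφ, ← rpow_omegaTetra_eq_asympRank ℂ (le_refl 2), Nat.cast_ofNat]
  constructor
  · rintro ⟨hTmax, hP1⟩
    refine ⟨by rw [hP1, Real.logb_one], ?_⟩
    rw [hTmax, Real.logb_rpow two_pos (by norm_num)]
  · rintro ⟨hp0, hsum⟩
    refine ⟨?_, ?_⟩
    · rw [← hsum, Real.rpow_logb two_pos (by norm_num) hT]
    · rw [← Real.rpow_logb two_pos (by norm_num) hP0, hp0, Real.rpow_zero]

/-- **THE LEAF, ALL POINTS**: `TetraExcessZero ⟺ ∀ φ ∈ X₄(ℂ), p_φ + d_φ ≤ ψ`. [cite: Strassen1988, Thm. 3.8] -/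
theorem tetraExcessZero_iff_forall_coord :
    TetraExcessZero ↔
      ∀ φ ∈ DTensorClass.asymptoticSpectrumDTensors ℂ 2,
        Real.logb 2 (φ (DTensorClass.mk (fun i : Fin 4 → Fin 2 => (ind (i 0 = i 1) : ℂ)))) +
          Real.logb 2 (φ (DTensorClass.mk (sixTetra ℂ 2 1))) ≤ omegaRect ℂ 2 1 2 := by
  rw [tetraExcessZero_iff_forall_spectrum (le_refl 2)]
  refine forall₂_congr fun φ hφ => ?_
  have hT : 0 < φ (DTensorClass.mk (tetra ℂ 2)) := by
    have h := one_le_spectrum_sixTetra (F := ℂ) (by norm_num : 1 ≤ 2) (by norm_num : 1 ≤ 2) hφ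
    rw [sixTetra_of_le (le_refl 2)] at h
    linarith
  rw [← logb_spectrum_tetra_two hφ, Nat.cast_ofNat, Real.logb_le_iff_le_rpow one_lt_two hT]

end Support

end Summit.MatrixMultiplication.MatrixMultiplication.Theorems.EdgePencil

end
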